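import Summits.Ventures.GridStability.Models.NE39SP
import Summits.Ventures.GridStability.Lyapunov.StructurePreservingLevelBound
import Summits.Ventures.GridStability.Lyapunov.StructurePreservingRoa
import HarnessLib

/-!
# GridStability/Bench/NE39SPEnergyRoa — rung «G2.b-SP NE39»: the certified energy-route region of
# attraction of the 49-node STRUCTURE-PRESERVING New England instance, with the RATIONAL level `c = 29/10`

Cell `gridfusion` (LADDER-GRIDFUSION), `plan/PARTITION.md` A25 (lead 2026-08-27T00:21:31Z /
00:27:46Z: data model-4 `bench/data/NE39/sp49/sp49.json` fddec35dcf838149 · typing model-2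
`Models/NE39SP.lean` · ASSEMBLY = this file, lyap-1: «the NE39 certificate file = ONE instantiation of
sublevel_subset_regionOfAttraction with a rational c below a certified lower bound of
levelBound θ β»); seat gridfusion-lyap-1 (g3); namespace `Summit.Ventures.GridStability.Bench.NE39SP`.
INPUTS: model-2's instance file (every hypothesis of the theorem of record discharged for the data:
`wellFormed`, `preconnected`, `edge_lower`, `window`, `theta_nonneg`, `theta_lt_pi_div_two`,
`isSyncEquilibrium`, and `roa_of_lt_levelBound` = the certificate MODULO the level), this seat's
`Lyapunov/StructurePreservingRoa.lean` (p475989, Bergen–Hill LAS for MODEL MV-3) and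
`Lyapunov/StructurePreservingLevelBound.lean` (p479424, rational lower bounds of the threshold).

THREE COLUMNS. CERTIFIED (kernel, here): `29/10 < c⋆(θ, β) = (1 − sin θ)·β·(π/2 − θ)/4` for
`θ = 2·arctan τ_max`, `τ_max = 34381253/167242430` (edge bus 9–G9, `θ ≈ 23.23°`),
`β = 5200202273/312500000` (line 26–29), by `levelBound_two_mul_arctan_ge_pi` (`arctan τ ≤ τ`,
`3.141592 < π`): the rational bound evaluates to `≈ 2.9212` (float `c⋆ ≈ 2.9354`; `29/10` is 98.8 %
of it) — `level_lt_levelBound`; and the two sentences below. MODELLED (model MV-3, MODEL-VALIDITY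
tokens of model-2's file: «MV-3 + lossless + MV-P + D(∀) + ω_s declared + V-frozen(LF) + |E|′(h12)»;
structure-preserving classical machines, constant voltage magnitudes, frequency-dependent loads with
UNPRINTED coefficients `Dᵢ > 0` — every statement holds for ALL such `D`): (`roa`) for every `D > 0`,
from every phase point of `S = {V(δ₀; δ, ω) ≤ 29/10} ∩ {|δᵢ − δⱼ| < π/2 on coupled pairs} ∩
{L(δ, ω) = L(δ₀, 0), ω_bus = 0}` a global solution of the structure-preserving field exists and
EVERY global solution stays in `S` and tends to `(δ₀, 0)`; (`tendsto_of_isSolution`) the same read on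
the printed second-order model (model-2's `Params.IsSolution`; `ω₀ = 0` here since `P⁰ := f(δ₀)`):
bus angles `δᵢ(t) → δ₀ᵢ`, generator frequency deviations `δ̇ᵢ(t) → 0`. VALIDATED (not here; A25
step for sos-4/sos-3 successor): `c = 29/10` against the transient energies of Padiyar Table 4.1's
cleared states (model-4 `bench/data/NE39/validated-Padiyar2013.json`) — expected far outside; print the
ratio. KILL data of A25: k1 (window < π/2) PASSES in model-2's file; k2 (a rational `c > 0` below a
certified bound) PASSES here. No sentence of this file says that the New England system or any grid
is stable. No definition, no named fact; standard axioms.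
-/

noncomputable section

open Set Filter Topology Real
open Summit.Ventures.GridStability.Models
open Summit.Ventures.GridStability.Models.StructurePreserving
open Summit.Ventures.GridStability.Models.NE39SP

namespace Summit.Ventures.GridStability.Bench.NE39SP

/-- **The certified level (kernel inequality): `29/10 < c⋆(θ, β)`** for the NE39-SP data
(`θ = 2·arctan(34381253/167242430)`, `β = 5200202273/312500000`), from the rational lower bound
`β·((1 − τ)²/(1 + τ²))·(1570796/10⁶ − 2τ)/4 ≈ 2.9212` of `levelBound_two_mul_arctan_ge_pi`.
CERTIFIED column. [folklore] -/
theorem level_lt_levelBound :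
    (29 / 10 : ℝ) < Lyapunov.StructurePreserving.levelBound NE39SP.θ (NE39SP.betaLF : ℝ) := by
  have hτ0 : (0 : ℝ) ≤ (NE39SP.tauLF : ℝ) := by
    exact_mod_cast (show (0 : ℚ) ≤ NE39SP.tauLF by norm_num [NE39SP.tauLF])
  have hτ1 : (NE39SP.tauLF : ℝ) < 1 := by
    exact_mod_cast (show NE39SP.tauLF < 1 by norm_num [NE39SP.tauLF])
  have hβ : (0 : ℝ) ≤ (NE39SP.betaLF : ℝ) := by
    exact_mod_cast (show (0 : ℚ) ≤ NE39SP.betaLF by norm_num [NE39SP.betaLF])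
  have h := Lyapunov.StructurePreserving.levelBound_two_mul_arctan_ge_pi hτ0 hτ1 hβ
  have hq : (29 / 10 : ℚ) < NE39SP.betaLF * ((1 - NE39SP.tauLF) ^ 2 / (1 + NE39SP.tauLF ^ 2))
      * (1570796 / 1000000 - 2 * NE39SP.tauLF) / 4 := by
    norm_num [NE39SP.tauLF, NE39SP.betaLF]
  have hr : (29 / 10 : ℝ) < (NE39SP.betaLF : ℝ) * ((1 - (NE39SP.tauLF : ℝ)) ^ 2
      / (1 + (NE39SP.tauLF : ℝ) ^ 2)) * (1570796 / 1000000 - 2 * (NE39SP.tauLF : ℝ)) / 4 := by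
    have h' := (Rat.cast_lt (K := ℝ)).2 hq
    push_cast at h'
    exact h'
  unfold NE39SP.θ
  exact hr.trans_le h

/-- **Rung «G2.b-SP NE39» — the certified region of attraction (phase-space form).** MODEL MV-3 at
the NE39-SP instance of record (column LF), for EVERY damping / load-frequency vector `D > 0`: from
every phase point `y = (δ, ω)` with every coupled branch inside `|δᵢ − δⱼ| < π/2`, on the momentum
level set through the equilibrium with zero bus pseudo-frequencies, and with energy
`V(δ₀; δ, ω) ≤ 29/10`, a global solution of the structure-preserving field exists, and EVERY global
solution from `y` keeps the window, the constraint set and `V ≤ 29/10` for all `t ≥ 0` and tends to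
`(δ₀, 0)`. One call of model-2's `NE39SP.roa_of_lt_levelBound` (= this seat's
`Lyapunov.StructurePreserving.sublevel_subset_regionOfAttraction` instantiated) at the certified
level `level_lt_levelBound`. No sentence here says a grid is stable.
[cite: Padiyar2013, App. D; §3.2 eq (3.2)] -/
theorem roa {D : Fin 49 → ℝ} (hD : ∀ i, 0 < D i) {y : (Fin 49 → ℝ) × (Fin 49 → ℝ)}
    (hy : y ∈ (params D).window ∩ (params D).constraintSet δ₀ ∧
      (params D).energy δ₀ y.1 y.2 ≤ 29 / 10) :
    (∃ X : ℝ → (Fin 49 → ℝ) × (Fin 49 → ℝ), X 0 = y ∧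
      ∀ T : ℝ, ∀ s ∈ Icc 0 T,
        HasDerivWithinAt X ((params D).shifted.phaseField (X s)) (Icc 0 T) s) ∧
    ∀ X : ℝ → (Fin 49 → ℝ) × (Fin 49 → ℝ), X 0 = y →
      (∀ T : ℝ, ∀ s ∈ Icc 0 T,
        HasDerivWithinAt X ((params D).shifted.phaseField (X s)) (Icc 0 T) s) →
      (∀ s, 0 ≤ s → X s ∈ (params D).window ∩ (params D).constraintSet δ₀ ∧
        (params D).energy δ₀ (X s).1 (X s).2 ≤ 29 / 10) ∧ Tendsto X atTop (𝓝 (δ₀, 0)) :=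
  NE39SP.roa_of_lt_levelBound hD
    (by
      have h := level_lt_levelBound
      unfold Lyapunov.StructurePreserving.levelBound at h
      exact h) hy

/-- **Rung «G2.b-SP NE39» in the printed second-order vocabulary** [cite: Padiyar2013, §3.2 eqs
(3.3)–(3.5)]: for EVERY `D > 0` and every solution `δ` of the structure-preserving model `params D`
AS PRINTED (model-2's `Params.IsSolution`; here `ω₀ = Σ P⁰/Σ D = 0` because `P⁰ := f(δ₀)`, so the
rotating frame is the original one) whose initial state has every coupled branch inside
`|δᵢ(0) − δⱼ(0)| < π/2`, momentum `L(δ(0), δ̇(0)) = L(δ₀, 0)` and energy `V(δ₀; δ(0), δ̇(0)) ≤ 29/10`: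
the window and `V ≤ 29/10` hold for all `t ≥ 0`, every node angle converges, `δᵢ(t) → δ₀ᵢ`, and
every generator frequency deviation tends to zero, `δ̇ᵢ(t) → 0` (`i` an internal node). MODEL MV-3;
no sentence here says a grid is stable. [cite: BergenHill1981] -/
theorem tendsto_of_isSolution {D : Fin 49 → ℝ} (hD : ∀ i, 0 < D i) {δ : ℝ → Fin 49 → ℝ}
    (hδ : (params D).IsSolution δ)
    (hwin : ∀ i j, (params D).b i j ≠ 0 → |δ 0 i - δ 0 j| < π / 2)
    (hL : (params D).momentum (δ 0) (fun i => deriv (fun u => δ u i) 0)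
      = (params D).momentum δ₀ 0)
    (hV : (params D).energy δ₀ (δ 0) (fun i => deriv (fun u => δ u i) 0) ≤ 29 / 10) :
    (∀ t, 0 ≤ t → (∀ i j, (params D).b i j ≠ 0 → |δ t i - δ t j| < π / 2) ∧
        (params D).energy δ₀ (δ t) (fun i => deriv (fun u => δ u i) t) ≤ 29 / 10) ∧
      Tendsto δ atTop (𝓝 δ₀) ∧
      ∀ i ∈ (params D).gen, Tendsto (fun t => deriv (fun u => δ u i) t) atTop (𝓝 0) := by
  have hs : (params D).shifted.IsSolution δ := by
    rw [(params D).shifted_eq_self_of_P0_eq_pe NE39SP.b_symm (NE39SP.params_P0 D)]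
    exact hδ
  exact Lyapunov.StructurePreserving.tendsto_of_isSolution (wellFormed hD) (by decide)
    (preconnected D) (fun i j => by rw [params_b]; exact b_nonneg i j) beta_pos (edge_lower D)
    theta_nonneg theta_lt_pi_div_two (window D) (isSyncEquilibrium D) level_lt_levelBound hs
    hwin hL hV

end Summit.Ventures.GridStability.Bench.NE39SP

end
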